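import Summits.CriticalPhenomena.SAWScalingLimit.Theorems.SAWLoopFugacityFlowIsingBoundaryRatioRSWDefs
import Summits.CriticalPhenomena.SAWScalingLimit.Theorems.SAWLoopFugacityFlowIsingBoundaryRatioChartAnnulusSeparation
import Literature.Probability.LatticeModels.RandomClusterConditionalDomination
import Literature.Probability.LatticeModels.IsingAnnulusCircuitFK
import Literature.Probability.Percolation.Crossings
import HarnessLib

/-!
# Rough half-annulus RSW (stub `stub_roughHalfAnnulusRSW`, line `fk-anchor-transfer`, crux `IsingBoundaryRatio`,
stmt-CriticalPhenomena-10650) — status BLOCKED; reduction to the mesh graph with extremal boundary conditions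

The registered stub (= `RoughHalfAnnulusRSW`, file `…IsingBoundaryRatioForgettingDefs.lean`) asks, uniformly in
every finite supergraph `(G, Λ)` of the local mesh graph and in every configuration `ξ` of the edges NOT touching
the lattice conformal half-annulus `Ann`, for `P(AnnSep ∩ {ω off Ann = ξ}) ≥ c·P(ω off Ann = ξ)` and
`P(AnnCross ∩ {ω off Ann = ξ}) ≤ (1-c)·P(ω off Ann = ξ)` under the free critical FK-Ising measure of `(G, Λ)`.

1. NOT PROVED (XL). Needed and absent from the tree: Chelkak–Duminil-Copin–Hongler 2016 Thm 1.1 (crossing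
   bounds in discrete topological rectangles in terms of the discrete extremal length only, uniform in the
   boundary conditions — its faithful transcription needs simply connected lattice domains with cyclically
   ordered boundary arcs), a bound on the discrete extremal length of the rectangle carved out of the annulus
   sites (Chelkak's toolbox §6–7 + Carathéodory convergence of `Ω_δ` with the corners `φ(±ρ), φ(±Mρ)`),
   and the planar topology of `Ω_δ ⊆ δℤ²` near the rough arcs (a rough-side-to-rough-side open crossing is
   a vertex cut between `In` and the outside; for small `δ` exactly ONE component of the annulus graph touches both rims —
   a closed lattice curve in `closure D` has its inside in `D`, where the grid is full, so a second rim-to-rim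
   component creeping along a rough arc is impossible, and necks of `∂D` narrower than `δ` only cut off bays
   that leave the largest mesh component). The tree's FK-Ising RSW (`fkIsing_rsw`, `fkIsing_annulusCrossing_le`)
   is for FLAT rectangles and FULL flat annuli, which do not fit inside `D` around a boundary point.
2. NOT REFUTED: junk sites of `Λ` in the ball (mesh point off `D` or off the largest mesh component) are
   ISOLATED in `G` by local agreement (no walk of positive length, no edge touching `Ann`); an edge of `ξ`
   touching `Ann` makes the cylinder null; `In = ∅` makes `AnnSep` certain and `AnnCross` impossible; the
   "two pieces" obstruction is excluded for small `δ` by the topology in item 1.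
3. PROVED HERE — the **boundary-condition and far-graph reduction** (Grimmett 2006 Lemma 4.13/4.14(b); CDH16
   Remark 2.2: a lower/upper bound uniform in `ξ` follows from the free/wired one), for ANY separation event
   `Sep` that is increasing, determined by the edges touching `Ann`, and blind to the graph off the sites of
   `In ∪ Ann`: `roughHalfAnnulusRSWOf_of_meshOf : RoughHalfAnnulusRSWMeshOf Sep → RoughHalfAnnulusRSWOf Sep`,
   whence `roughHalfAnnulusRSW_of_mesh : RoughHalfAnnulusRSWMeshOf AnnSep → RoughHalfAnnulusRSW` (the path
   form `Sep = AnnPathSepG` is the companion file `…RoughHalfAnnulusRSWPath.lean`). The residual TARGET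
   `RoughHalfAnnulusRSWMeshOf AnnSep` asks the two bounds for the random-cluster measure of the LOCAL graph `⟨U⟩` spanned by the edges `U` of the
   MESH graph `Ω_δ` touching the annulus, FREE for `Sep` and with all vertices off the annulus WIRED together
   for `AnnCross` — no far graph, no `ξ`, no cylinder. Ingredients: `AnnSep`, `AnnCross` are increasing and
   measurable w.r.t. the edges touching `Ann` (for `AnnCross` once no edge joins `In` straight to the outside,
   which for small mesh is `stub_chartAnnulusSeparation` + the boundary value `φ(0) = a`:
   `exists_forall_not_adj_of_mem_annIn`); they only see the edges at the sites of `In ∪ Ann`, where `G` and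
   `Ω_δ` agree (`annSep_of_agree`, `annCross_of_agree`); conditional domination by the extremal local
   measures (`rcMeasure_real_inter_cylinder_le_mul_fromEdgeSet[_of_isLowerSet]`).

References: Grimmett, *The Random-Cluster Model* (2006), Lemma (4.13), (4.14)(b) [`Grimmett2006`]; Chelkak,
Duminil-Copin, Hongler, EJP 21 (2016), Thm 1.1, Rem. 2.2, arXiv:1312.7785 [`ChelkakDuminilCopinHongler2016`];
Chelkak, *Robust discrete complex analysis: a toolbox*, Ann. Probab. 44 (2016), §6–7.
-/

noncomputable section

open scoped Classical Topology
open Filter Set Metric MeasureTheory SimpleGraph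
open Literature.Probability.LatticeModels Literature.Probability.RandomPlanarGeometry
open Literature.Probability.Percolation (BondConfig openConnIn openGraph)
open UpperHalfPlane (upperHalfPlaneSet)

namespace Summit.CriticalPhenomena.SAWScalingLimit.Theorems.IsingBoundaryRatio

section Events

variable {Λ : Finset (Site 2)}

/-- The open separation event is increasing in the configuration. [folklore] -/
theorem isUpperSet_annSep (H : SimpleGraph Λ) (In Ann : Set Λ) :
    IsUpperSet {ω : BondConfig Λ | AnnSep H In Ann ω} := by
  rintro ω ω' h ⟨S, hS, hconn, hcut⟩
  exact ⟨S, hS, fun u hu v hv =>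
    Literature.Probability.Percolation.isUpperSet_openConnIn Ann u v h (hconn u hu v hv), hcut⟩

/-- The open radial crossing event is increasing in the configuration. [folklore] -/
theorem isUpperSet_annCross (H : SimpleGraph Λ) (In Ann : Set Λ) :
    IsUpperSet {ω : BondConfig Λ | AnnCross H In Ann ω} :=
  fun _ _ h ⟨a, b, p, ha, hb, hsupp, hopen⟩ => ⟨a, b, p, ha, hb, hsupp, fun e he => h (hopen e he)⟩

/-- **`AnnSep` is measurable with respect to the edges touching the annulus**: for a configuration made
of edges of `H`, restricting it to these edges does not change `AnnSep` (the connecting open paths live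
inside `Ann`). [folklore] -/
theorem annSep_inter_annEdgeFinset_iff {H : SimpleGraph Λ} {In Ann : Set Λ} {ω : BondConfig Λ}
    (hω : ω ⊆ H.edgeSet) : AnnSep H In Ann (ω ∩ ↑(annEdgeFinset H Ann)) ↔ AnnSep H In Ann ω := by
  refine ⟨isUpperSet_annSep H In Ann inter_subset_left,
    fun ⟨S, hS, hconn, hcut⟩ => ⟨S, hS, fun u hu v hv => ?_, hcut⟩⟩
  obtain ⟨hu', hv', hr⟩ := hconn u hu v hv
  refine ⟨hu', hv', ?_⟩
  have key : (openGraph (ω ∩ ↑(annEdgeFinset H Ann))).induce Ann = (openGraph ω).induce Ann := by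
    ext x y
    simp only [comap_adj, Function.Embedding.coe_subtype, Literature.Probability.Percolation.openGraph_adj,
      Set.mem_inter_iff, Finset.mem_coe, mem_annEdgeFinset]
    exact ⟨fun ⟨⟨h1, _⟩, h2⟩ => ⟨h1, h2⟩,
      fun ⟨h1, h2⟩ => ⟨⟨h1, hω h1, x, x.2, Sym2.mem_mk_left _ _⟩, h2⟩⟩
  rw [key]
  exact hr

/-- **`AnnCross` is measurable with respect to the edges touching the annulus**, provided no edge of `H`
joins `In` directly to the complement of `In ∪ Ann` (every edge of a radial crossing then touches `Ann`).
[folklore] -/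
theorem annCross_inter_annEdgeFinset_iff {H : SimpleGraph Λ} {In Ann : Set Λ} {ω : BondConfig Λ}
    (hIO : ∀ a ∈ In, ∀ b : Λ, b ∉ In ∪ Ann → ¬ H.Adj a b) :
    AnnCross H In Ann (ω ∩ ↑(annEdgeFinset H Ann)) ↔ AnnCross H In Ann ω := by
  refine ⟨isUpperSet_annCross H In Ann inter_subset_left, fun ⟨a, b, p, ha, hb, hsupp, hopen⟩ =>
    ⟨a, b, p, ha, hb, hsupp, fun e he => ⟨hopen e he, ?_⟩⟩⟩
  rw [Finset.mem_coe, mem_annEdgeFinset]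
  refine ⟨p.edges_subset_edgeSet he, ?_⟩
  revert he
  refine Sym2.ind (fun x y he => ?_) e
  have hx := hsupp x (p.fst_mem_support_of_mem_edges he)
  have hy := hsupp y (p.snd_mem_support_of_mem_edges he)
  have hadj : H.Adj x y := p.adj_of_mem_edges he
  by_contra hne
  push Not at hne
  have hyA : y ∉ Ann := fun h => hne y h (Sym2.mem_mk_right x y)
  rcases hx with rfl | rfl | hx
  · rcases hy with rfl | rfl | hy
    exacts [hadj.ne rfl, hIO _ ha _ hb hadj, hyA hy]
  · rcases hy with rfl | rfl | hy
    exacts [hIO _ ha _ hb hadj.symm, hadj.ne rfl, hyA hy]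
  · exact hne x hx (Sym2.mem_mk_left x y)

/-- **Prefix of a walk up to its first vertex outside `P`**: all darts of the prefix START inside `P`,
and its support lies inside the original support. [folklore] -/
theorem exists_prefix_darts {V : Type*} {G : SimpleGraph V} (P : V → Prop) {u v : V}
    (p : G.Walk u v) (hv : ¬ P v) :
    ∃ (w : V) (q : G.Walk u w), ¬ P w ∧ (∀ d ∈ q.darts, P d.fst) ∧ q.support ⊆ p.support := by
  induction p with
  | nil => exact ⟨_, .nil, hv, by simp, by simp⟩
  | @cons u x v h p' ih =>
    by_cases hu : P u
    · obtain ⟨w, q', hw, hd, hs⟩ := ih hv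
      refine ⟨w, .cons h q', hw, fun d hd' => ?_, fun z hz => ?_⟩
      · rw [Walk.darts_cons, List.mem_cons] at hd'
        rcases hd' with rfl | hd'
        exacts [hu, hd d hd']
      · rw [Walk.support_cons, List.mem_cons] at hz ⊢
        rcases hz with rfl | hz
        exacts [Or.inl rfl, Or.inr (hs hz)]
    · exact ⟨u, .nil, hu, by simp, by simp⟩

/-- A walk whose darts are adjacencies of `G'` is a `G'`-walk with the same support and edges. [folklore] -/
theorem exists_walk_of_darts {V : Type*} {G G' : SimpleGraph V} {u w : V} (q : G.Walk u w)
    (h : ∀ d ∈ q.darts, G'.Adj d.fst d.snd) :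
    ∃ q' : G'.Walk u w, q'.support = q.support ∧ q'.edges = q.edges := by
  refine ⟨q.transfer G' fun e he => ?_, q.support_transfer _, q.edges_transfer _⟩
  obtain ⟨d, hd, rfl⟩ := List.mem_map.1 he
  exact (mem_edgeSet G').2 (h d hd)

/-- Two graphs on `↥Λ` with the same edges at the sites of `Ann` have the same edges touching `Ann`.
[folklore] -/
theorem annEdgeFinset_eq_of_agree {H H' : SimpleGraph Λ} {Ann : Set Λ}
    (hag : ∀ u ∈ Ann, ∀ v, H.Adj u v ↔ H'.Adj u v) : annEdgeFinset H Ann = annEdgeFinset H' Ann := by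
  have key : ∀ e : Sym2 Λ, (∃ v ∈ Ann, v ∈ e) → (e ∈ H.edgeSet ↔ e ∈ H'.edgeSet) := by
    intro e ⟨v, hvA, hve⟩
    revert hve
    refine Sym2.ind (fun x y hve => ?_) e
    rcases Sym2.mem_iff.1 hve with rfl | rfl
    · rw [mem_edgeSet, mem_edgeSet]; exact hag _ hvA _
    · rw [mem_edgeSet, mem_edgeSet, H.adj_comm, H'.adj_comm]; exact hag _ hvA _
  ext e
  simp only [mem_annEdgeFinset]
  exact ⟨fun ⟨he, hv⟩ => ⟨(key e hv).1 he, hv⟩, fun ⟨he, hv⟩ => ⟨(key e hv).2 he, hv⟩⟩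

/-- **`AnnSep` only sees the edges at the sites of `In ∪ Ann`**: a separating set for `H'` separates for
`H` (cut an `H`-walk from `In` at its first exit from `In ∪ Ann`: the prefix is an `H'`-walk). [folklore] -/
theorem annSep_of_agree {H H' : SimpleGraph Λ} {In Ann : Set Λ}
    (hag : ∀ u ∈ In ∪ Ann, ∀ v, H.Adj u v ↔ H'.Adj u v) {ω : BondConfig Λ}
    (h : AnnSep H' In Ann ω) : AnnSep H In Ann ω := by
  obtain ⟨S, hS, hconn, hcut⟩ := h
  refine ⟨S, hS, hconn, fun a b ha hb p => ?_⟩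
  obtain ⟨w, q, hw, hd, hs⟩ := exists_prefix_darts (fun z => z ∈ In ∪ Ann) p hb
  obtain ⟨q', hq's, -⟩ := exists_walk_of_darts (G' := H') q fun d hdq => (hag _ (hd d hdq) _).1 d.adj
  obtain ⟨z, hz, hzS⟩ := hcut a w ha hw q'
  exact ⟨z, hs (hq's ▸ hz), hzS⟩

/-- **`AnnCross` only sees the edges at the sites of `In ∪ Ann`**: every dart of a radial crossing has an
endpoint in `In ∪ Ann`, so the crossing transfers. [folklore] -/
theorem annCross_of_agree {H H' : SimpleGraph Λ} {In Ann : Set Λ}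
    (hag : ∀ u ∈ In ∪ Ann, ∀ v, H.Adj u v ↔ H'.Adj u v) {ω : BondConfig Λ}
    (h : AnnCross H In Ann ω) : AnnCross H' In Ann ω := by
  obtain ⟨a, b, p, ha, hb, hsupp, hopen⟩ := h
  have key : ∀ d ∈ p.darts, H'.Adj d.fst d.snd := by
    intro d hd
    have h1 := hsupp _ (p.dart_fst_mem_support_of_mem_darts hd)
    have h2 := hsupp _ (p.dart_snd_mem_support_of_mem_darts hd)
    have hadj : H.Adj d.fst d.snd := d.adj
    by_cases hf : d.fst ∈ In ∪ Ann
    · exact (hag _ hf _).1 hadj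
    · have hsnd : d.snd ∈ In ∪ Ann := by
        rcases h2 with h2 | h2 | h2
        · exact Or.inl (h2 ▸ ha)
        · exfalso
          rcases h1 with h1 | h1 | h1
          exacts [hf (Or.inl (h1 ▸ ha)), hadj.ne (h1.trans h2.symm), hf (Or.inr h1)]
        · exact Or.inr h2
      exact ((hag _ hsnd _).1 hadj.symm).symm
  obtain ⟨p', hp's, hp'e⟩ := exists_walk_of_darts p key
  exact ⟨a, b, p', ha, hb, fun z hz => hsupp z (hp's ▸ hz), fun e he => hopen e (hp'e ▸ he)⟩

/-- Local agreement with `Ω_δ` passes from `(G, Λ)` to `(Ω_δ, Λ)` (only the closure condition remains).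
[folklore] -/
theorem localAgreement_discreteDomainGraph {Ω : Set ℂ} {p : ℂ} {ε δ : ℝ} {G : SimpleGraph (Site 2)}
    {Λ : Finset (Site 2)} (h : LocalAgreement Ω p ε δ G Λ) :
    LocalAgreement Ω p ε δ (discreteDomainGraph Ω δ) Λ :=
  fun w hw hball v => ⟨Iff.rfl, (h w hw hball v).2⟩

/-- Under local agreement, `G.comap val` and `Ω_δ.comap val` have the same edges at every site of
`In ∪ Ann` (their mesh points lie in the ball). [folklore] -/
theorem adj_comap_iff_of_localAgreement {D : DobrushinDomain}
    {φ : ConformalEquiv upperHalfPlaneSet D.carrier} {M ε δ ρ : ℝ} {G : SimpleGraph (Site 2)}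
    {Λ : Finset (Site 2)} (h : LocalAgreement D.carrier (D.pt 0) ε δ G Λ) :
    ∀ u ∈ annIn D φ ε δ ρ Λ ∪ annBody D φ M ε δ ρ Λ, ∀ v : Λ,
      (G.comap (Subtype.val : Λ → Site 2)).Adj u v ↔
        ((discreteDomainGraph D.carrier δ).comap (Subtype.val : Λ → Site 2)).Adj u v := by
  intro u hu v
  rw [comap_adj, comap_adj]
  exact (h u.1 u.2 (hu.elim (fun hu => hu.1) fun hu => hu.1) v.1).1

variable {V : Type*} [Fintype V] [DecidableEq V] (G : SimpleGraph V) [DecidableRel G.Adj] in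
/-- Two events that agree on the subsets of `E(G)` have the same random-cluster probability
(`φ^B_{G,p,q}` is a sum of Dirac masses at the subsets of `E(G)`). [folklore] -/
theorem rcMeasure_real_congr_of_subset {p q : ℝ} (hp : p ∈ Set.Icc (0 : ℝ) 1) (hq : 0 < q)
    (B : Set V) {S S' : Set (BondConfig V)}
    (h : ∀ ω : BondConfig V, ω ⊆ G.edgeSet → (ω ∈ S ↔ ω ∈ S')) :
    (rcMeasure G p q B).real S = (rcMeasure G p q B).real S' := by
  rw [rcMeasure_real_apply G hp hq B S, rcMeasure_real_apply G hp hq B S']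
  refine Finset.sum_congr rfl fun ω hω => ?_
  rw [if_congr (h _ fun e he => mem_edgeFinset.1 (Finset.mem_powerset.1 hω (Finset.mem_coe.1 he))) rfl rfl]

/-- **Boundary-condition reduction for one finite volume**: with `U = annEdgeFinset H Ann`, an increasing
event `Sep` determined by the edges of `U`, and no edge of `H` from `In` to the complement of `In ∪ Ann`, the
bounds `φ^free_{⟨U⟩}(Sep) ≥ c`, `φ^{wired off Ann}_{⟨U⟩}(AnnCross) ≤ 1 - c` give, under `φ^free_{H,p,2}`
and for every `ξ`, `c·P(ω ∖ U = ξ) ≤ P(Sep ∩ {ω ∖ U = ξ})` and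
`P(AnnCross ∩ {ω ∖ U = ξ}) ≤ (1-c)·P(ω ∖ U = ξ)`. [cite: Grimmett2006, Lemma (4.13) and Lemma (4.14)(b)] -/
theorem cylinder_bounds_of_local (H : SimpleGraph Λ) (In Ann : Set Λ) (Sep : BondConfig Λ → Prop)
    (hSmono : IsUpperSet {ω | Sep ω})
    (hSloc : ∀ ω : BondConfig Λ, ω ⊆ H.edgeSet → (Sep (ω ∩ ↑(annEdgeFinset H Ann)) ↔ Sep ω))
    {p : ℝ} (hp : p ∈ Set.Icc (0 : ℝ) 1) {c : ℝ}
    (hIO : ∀ a ∈ In, ∀ b : Λ, b ∉ In ∪ Ann → ¬ H.Adj a b)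
    (h1 : c ≤ (rcMeasure (fromEdgeSet (↑(annEdgeFinset H Ann) : Set (Sym2 Λ))) p 2 ∅).real {ω | Sep ω})
    (h2 : (rcMeasure (fromEdgeSet (↑(annEdgeFinset H Ann) : Set (Sym2 Λ))) p 2 Annᶜ).real
      {ω | AnnCross H In Ann ω} ≤ 1 - c)
    (ξ : Set (Sym2 Λ)) :
    c * (rcMeasure H p 2 ∅).real {ω | ω ∩ (↑(annEdgeFinset H Ann) : Set (Sym2 Λ))ᶜ = ξ} ≤
        (rcMeasure H p 2 ∅).real
          ({ω | Sep ω} ∩ {ω | ω ∩ (↑(annEdgeFinset H Ann) : Set (Sym2 Λ))ᶜ = ξ}) ∧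
      (rcMeasure H p 2 ∅).real
          ({ω | AnnCross H In Ann ω} ∩ {ω | ω ∩ (↑(annEdgeFinset H Ann) : Set (Sym2 Λ))ᶜ = ξ}) ≤
        (1 - c) * (rcMeasure H p 2 ∅).real {ω | ω ∩ (↑(annEdgeFinset H Ann) : Set (Sym2 Λ))ᶜ = ξ} := by
  set Uf : Finset (Sym2 Λ) := annEdgeFinset H Ann
  have hUE : Uf ⊆ H.edgeFinset := fun e he => mem_edgeFinset.2 (mem_annEdgeFinset.1 he).1
  set P := rcMeasure H p 2 ∅
  haveI : IsProbabilityMeasure P := isProbabilityMeasure_rcMeasure H hp two_pos ∅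
  set C : Set (BondConfig Λ) := {ω | ω ∩ (↑Uf : Set (Sym2 Λ))ᶜ = ξ} with hC
  constructor
  · -- the separation event: its complement is decreasing, dominated by the FREE local measure
    have key := rcMeasure_real_inter_cylinder_le_mul_fromEdgeSet_of_isLowerSet H hp one_le_two ∅
      Uf hUE ξ hSmono.compl
    haveI : IsProbabilityMeasure (rcMeasure (fromEdgeSet (↑Uf : Set (Sym2 Λ))) p 2 ∅) :=
      isProbabilityMeasure_rcMeasure _ hp two_pos ∅
    have hloc : (rcMeasure (fromEdgeSet (↑Uf : Set (Sym2 Λ))) p 2 ∅).real {ω : BondConfig Λ | Sep ω}ᶜ ≤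
        1 - c := by
      rw [probReal_compl_eq_one_sub MeasurableSet.of_discrete]; linarith
    have hagree : P.real ({ω : BondConfig Λ | ω ∩ ↑Uf ∈ {ω : BondConfig Λ | Sep ω}ᶜ} ∩ C) =
        P.real ({ω : BondConfig Λ | Sep ω}ᶜ ∩ C) := by
      refine rcMeasure_real_congr_of_subset H hp two_pos ∅ fun ω hω => ?_
      simp only [Set.mem_inter_iff, Set.mem_setOf_eq, Set.mem_compl_iff]
      exact and_congr_left' (hSloc ω hω).not
    have hb : P.real ({ω : BondConfig Λ | Sep ω}ᶜ ∩ C) ≤ (1 - c) * P.real C := by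
      rw [← hagree, mul_comm]
      exact key.trans (mul_le_mul_of_nonneg_left hloc measureReal_nonneg)
    simpa only [compl_compl, sub_sub_cancel] using one_sub_mul_le_real_compl_inter (μ := P) hb
  · -- the radial crossing: increasing, dominated by the WIRED local measure
    by_cases hξ : ∀ e ∈ ξ, ∀ x ∈ e, x ∈ Annᶜ
    · have key := rcMeasure_real_inter_cylinder_le_mul_fromEdgeSet H hp one_le_two ∅ Uf hUE ξ
        (W := Annᶜ) (Set.empty_subset _) hξ (isUpperSet_annCross H In Ann)
      have hagree :
          P.real ({ω : BondConfig Λ | ω ∩ ↑Uf ∈ {ω : BondConfig Λ | AnnCross H In Ann ω}} ∩ C) =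
          P.real ({ω : BondConfig Λ | AnnCross H In Ann ω} ∩ C) := by
        refine rcMeasure_real_congr_of_subset H hp two_pos ∅ fun ω _ => ?_
        simp only [Set.mem_inter_iff, Set.mem_setOf_eq]
        exact and_congr_left' (annCross_inter_annEdgeFinset_iff (In := In) (Ann := Ann) (ω := ω) hIO)
      rw [← hagree, mul_comm]
      exact key.trans (mul_le_mul_of_nonneg_left h2 measureReal_nonneg)
    · -- an edge of `ξ` touches `Ann`: the cylinder is null
      have hC0 : P.real C = 0 := by
        rw [show (0 : ℝ) = P.real (∅ : Set (BondConfig Λ)) by simp]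
        refine rcMeasure_real_congr_of_subset H hp two_pos ∅ fun ω hω => ?_
        simp only [Set.mem_empty_iff_false, iff_false, hC, Set.mem_setOf_eq]
        refine fun hωξ => hξ fun e he x hx hxA => ?_
        have he' : e ∈ ω ∩ (↑Uf : Set (Sym2 Λ))ᶜ := hωξ ▸ he
        exact he'.2 (Finset.mem_coe.2 (mem_annEdgeFinset.2 ⟨hω he'.1, x, hxA, hx⟩))
      have h0 : P.real ({ω : BondConfig Λ | AnnCross H In Ann ω} ∩ C) = 0 :=
        le_antisymm ((measureReal_mono Set.inter_subset_right).trans hC0.le) measureReal_nonneg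
      rw [h0, hC0, mul_zero]

end Events

/-- **No edge of a locally agreeing graph joins the inside of the half-annulus directly to the complement
of inside-and-annulus**, once `ρ < ρ₁(φ, M, ε)` and the mesh is small: such an edge is an edge of `Ω_δ`, its
far endpoint has chart radius `< Mρ` (`stub_chartAnnulusSeparation` for the one-edge walk) and mesh point
`φ(w)`, `‖w‖ < Mρ₁`, inside `B(a, ε)` (boundary value `φ(0) = a`). [folklore] -/
theorem exists_forall_not_adj_of_mem_annIn {D : DobrushinDomain}
    {φ : ConformalEquiv upperHalfPlaneSet D.carrier} (hφ : D.IsChordalUniformizing φ)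
    {M : ℝ} (hM : 1 < M) {ε : ℝ} (hε : 0 < ε) :
    ∃ ρ₁ : ℝ, 0 < ρ₁ ∧ ∀ (ρ : ℝ), 0 < ρ → ρ < ρ₁ → ∀ᶠ δ in 𝓝[>] (0 : ℝ),
      ∀ (G : SimpleGraph (Site 2)) (Λ : Finset (Site 2)),
        LocalAgreement D.carrier (D.pt 0) ε δ G Λ →
        ∀ a ∈ annIn D φ ε δ ρ Λ, ∀ b : Λ, b ∉ annIn D φ ε δ ρ Λ ∪ annBody D φ M ε δ ρ Λ →
          ¬ (G.comap (Subtype.val : Λ → Site 2)).Adj a b := by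
  obtain ⟨r, hr, hball⟩ := Metric.tendsto_nhdsWithin_nhds.1 hφ.1 ε hε
  have hM0 : 0 < M := one_pos.trans hM
  refine ⟨r / M, div_pos hr hM0, fun ρ hρ hρr => ?_⟩
  have hMr : M * ρ < r := by rwa [lt_div_iff₀ hM0, mul_comm] at hρr
  filter_upwards [stub_chartAnnulusSeparation D φ hφ ρ (M * ρ) hρ (lt_mul_left hρ hM)] with δ hδ G Λ hLA a
    ha b hb hadj
  rw [comap_adj] at hadj
  have hΩ : (discreteDomainGraph D.carrier δ).Adj a.1 b.1 := ((hLA a.1 a.2 ha.1 b.1).1).1 hadj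
  obtain ⟨-, hbD, -⟩ := meshPoint_mem_of_discreteDomainGraph_adj hΩ
  have hbM : ‖φ.symm (meshPoint δ b.1)‖ < M * ρ := by
    by_contra hcon
    obtain ⟨z, hz, hz1, hz2⟩ := hδ a.1 b.1 (Walk.cons hΩ Walk.nil) ha.2 (not_lt.1 hcon)
    simp only [Walk.support_cons, Walk.support_nil, List.mem_cons, List.not_mem_nil, or_false] at hz
    rcases hz with rfl | rfl
    exacts [absurd ha.2 (not_le.2 hz1), hcon hz2]
  have hbball : dist (φ (φ.symm (meshPoint δ b.1))) (D.pt 0) < ε :=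
    hball (φ.symm_mapsTo hbD) (by rw [dist_zero_right]; exact hbM.trans hMr)
  rw [φ.apply_symm_apply hbD] at hbball
  rcases le_or_gt ‖φ.symm (meshPoint δ b.1)‖ ρ with hle | hgt
  exacts [hb (Or.inl ⟨hbball, hle⟩), hb (Or.inr ⟨hbball, hgt, hbM⟩)]

/-- **The reduction, for any admissible separation event.** If `Sep` is increasing, determined by the edges
touching `Ann` (for configurations made of edges of the graph), and unchanged when the graph is replaced by
another one with the same edges at the sites of `In ∪ Ann`, then the mesh-graph form with extremal boundary
conditions implies the conditional-cylinder form, uniform in the supergraph `(G, Λ)` and in `ξ`: `(Ω_δ, Λ)`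
agrees locally too, the two graphs on `↥Λ` have the same local graph and events; then
`cylinder_bounds_of_local` with `exists_forall_not_adj_of_mem_annIn` along `𝓝[>] 0`.
[cite: Grimmett2006, Lemma (4.13) and Lemma (4.14)(b)] -/
theorem roughHalfAnnulusRSWOf_of_meshOf
    (Sep : ∀ {Λ : Finset (Site 2)}, SimpleGraph Λ → Set Λ → Set Λ → BondConfig Λ → Prop)
    (hmono : ∀ {Λ : Finset (Site 2)} (H : SimpleGraph Λ) (In Ann : Set Λ),
      IsUpperSet {ω : BondConfig Λ | Sep H In Ann ω})
    (hloc : ∀ {Λ : Finset (Site 2)} (H : SimpleGraph Λ) (In Ann : Set Λ) (ω : BondConfig Λ),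
      ω ⊆ H.edgeSet → (Sep H In Ann (ω ∩ ↑(annEdgeFinset H Ann)) ↔ Sep H In Ann ω))
    (hag : ∀ {Λ : Finset (Site 2)} {H H' : SimpleGraph Λ} {In Ann : Set Λ},
      (∀ u ∈ In ∪ Ann, ∀ v, H.Adj u v ↔ H'.Adj u v) →
        ∀ ω : BondConfig Λ, Sep H In Ann ω ↔ Sep H' In Ann ω)
    (hmesh : RoughHalfAnnulusRSWMeshOf Sep) : RoughHalfAnnulusRSWOf Sep := by
  intro D φ hφ M hM
  obtain ⟨c, hc, hcε⟩ := hmesh D φ hφ M hM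
  refine ⟨c, hc, fun ε hε => ?_⟩
  obtain ⟨ρ₀, hρ₀, hρ⟩ := hcε ε hε
  obtain ⟨ρ₁, hρ₁, hρ'⟩ := exists_forall_not_adj_of_mem_annIn hφ hM hε
  refine ⟨min ρ₀ ρ₁, lt_min hρ₀ hρ₁, fun ρ hρpos hρlt => ?_⟩
  filter_upwards [hρ ρ hρpos (hρlt.trans_le (min_le_left _ _)),
    hρ' ρ hρpos (hρlt.trans_le (min_le_right _ _))] with δ hδ hδ' G _ Λ hLA ξ
  intro H In Ann U P
  have hp : (1 - Real.exp (-2 * criticalBetaTwo)) ∈ Set.Icc (0 : ℝ) 1 :=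
    fkIsingParam_mem_Icc criticalBetaTwo_pos.le
  set H' : SimpleGraph Λ := (discreteDomainGraph D.carrier δ).comap Subtype.val with hH'
  have hagr : ∀ u ∈ In ∪ Ann, ∀ v : Λ, H.Adj u v ↔ H'.Adj u v :=
    adj_comap_iff_of_localAgreement (φ := φ) (M := M) (ρ := ρ) hLA
  have hagr' : ∀ u ∈ In ∪ Ann, ∀ v : Λ, H'.Adj u v ↔ H.Adj u v := fun u hu v => (hagr u hu v).symm
  have hE : annEdgeFinset H Ann = annEdgeFinset H' Ann :=
    annEdgeFinset_eq_of_agree fun u hu => hagr u (Or.inr hu)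
  have hS : {ω : BondConfig Λ | Sep H In Ann ω} = {ω | Sep H' In Ann ω} := Set.ext (hag hagr)
  have hC : {ω : BondConfig Λ | AnnCross H In Ann ω} = {ω | AnnCross H' In Ann ω} :=
    Set.ext fun ω => ⟨annCross_of_agree hagr, annCross_of_agree hagr'⟩
  obtain ⟨h1', h2'⟩ := hδ Λ (localAgreement_discreteDomainGraph hLA)
  have h1 : c ≤ (rcMeasure (fromEdgeSet (↑(annEdgeFinset H Ann) : Set (Sym2 Λ)))
      (1 - Real.exp (-2 * criticalBetaTwo)) 2 ∅).real {ω | Sep H In Ann ω} := by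
    rw [hE, hS]; exact h1'
  have h2 : (rcMeasure (fromEdgeSet (↑(annEdgeFinset H Ann) : Set (Sym2 Λ)))
      (1 - Real.exp (-2 * criticalBetaTwo)) 2 Annᶜ).real {ω | AnnCross H In Ann ω} ≤ 1 - c := by
    rw [hE, hC]; exact h2'
  have key := cylinder_bounds_of_local H In Ann (Sep H In Ann) (hmono H In Ann) (hloc H In Ann) hp
    (hδ' G Λ hLA) h1 h2 ξ
  rwa [coe_annEdgeFinset] at key

/-- **The reduction for the registered stub** (`Sep = AnnSep`): the mesh-graph form with extremal boundary
conditions `RoughHalfAnnulusRSWMeshOf AnnSep` implies `RoughHalfAnnulusRSW`.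
[cite: Grimmett2006, Lemma (4.13) and Lemma (4.14)(b)] -/
theorem roughHalfAnnulusRSW_of_mesh : RoughHalfAnnulusRSWMeshOf AnnSep → RoughHalfAnnulusRSW := fun h =>
  roughHalfAnnulusRSWOf_annSep_iff.1 <|
    roughHalfAnnulusRSWOf_of_meshOf AnnSep isUpperSet_annSep
      (fun _ _ _ _ hω => annSep_inter_annEdgeFinset_iff hω)
      (fun hag _ => ⟨annSep_of_agree fun u hu v => (hag u hu v).symm, annSep_of_agree hag⟩) h

end Summit.CriticalPhenomena.SAWScalingLimit.Theorems.IsingBoundaryRatio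

end
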